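import Literature.Analysis.FunctionSpaces.TorusAnalyticSeminorm
import Literature.Analysis.FunctionSpaces.TorusTrigPoly
import HarnessLib

/-!
# Decay of Fourier coefficients from the analyticity seminorms `⟦f⟧_{n,R}`

Analysis/FunctionSpaces support file (everything proved; no definitions, no named facts). For a smooth
vector field `f : T^d → ℝ^d` the Fourier coefficients of a derivative are
`𝓕(∂ⱼf)(k) = 2πi kⱼ 𝓕f(k)` (Grafakos 2014, Prop. 3.2.6 (8); tree
`Torus.mFourierCoeff_complexify_partialDeriv`), and `‖𝓕g(k)‖ ≤ ‖g‖_∞`; iterating `n` times in one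
direction `j` gives the classical decay-by-integration-by-parts

  `‖𝓕f(k)‖ (2π|kⱼ|)ⁿ ≤ sup ‖∂ⱼⁿ f‖ ≤ derivSup n f`   (`Torus.norm_mFourierCoeff_mul_pow_le_derivSup`),

hence, in terms of the Armstrong–Vicol seminorms (`TorusAnalyticSeminorm`),
`‖𝓕f(k)‖ ≤ ⟦f⟧_{n,R} · n! Rⁿ / ((n+1)² (2π|kⱼ|)ⁿ)` (`Torus.norm_mFourierCoeff_le_of_dnorm_le`), and the
**geometric decay** obtained by optimising `n` against `|k|` with `n! ≤ nⁿ`: if `⟦f⟧_{n,R} ≤ C` and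
`R n ≤ π |kⱼ|` then `‖𝓕f(k)‖ ≤ C 2^{-n}/(n+1)²` (`Torus.norm_mFourierCoeff_le_geometric_of_dnorm_le`) —
the mechanism "the `s!`-growth is what makes the optimisation over the number of integrations by
parts give an exponential" behind the reset-spread step S3e′ of the K1L one-level split (cell
`ad-ideate`, F-lead-3).

## References

* L. Grafakos, *Classical Fourier Analysis*, 3rd ed. (Springer GTM 249, 2014), Prop. 3.2.6 (8)
  (`𝓕(∂^α f)(k) = (2πik)^α 𝓕f(k)`; decay of Fourier coefficients of smooth functions by integration by
  parts, §3.3.1). [`Grafakos2014`]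
* S. Armstrong, V. Vicol, Ann. PDE 11 (2025), arXiv:2305.05048, App. A (A.1) (the seminorms). [`ArmstrongVicol2025`]
-/

noncomputable section

open Set Function Complex UnitAddTorus MeasureTheory

namespace Literature.Analysis.FunctionSpaces

namespace Torus

variable {d : Type*} [Fintype d] [DecidableEq d]

/-- `𝓕(∂ⱼⁿ f)(k) = (2πi kⱼ)ⁿ 𝓕f(k)` for a smooth vector field, `∂ⱼⁿ = iterPartialDeriv (replicate n j)`.
[cite: Grafakos2014, Prop. 3.2.6 (8)] -/
theorem mFourierCoeff_complexify_iterPartialDeriv_replicate {f : UnitAddTorus d → EuclideanSpace ℝ d}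
    (hf : IsSmooth f) (j : d) (k : d → ℤ) :
    ∀ n : ℕ, mFourierCoeff (EuclideanSpace.complexify ∘ iterPartialDeriv (List.replicate n j) f) k =
      (2 * Real.pi * Complex.I * (k j)) ^ n • mFourierCoeff (EuclideanSpace.complexify ∘ f) k
  | 0 => by simp
  | n + 1 => by
    rw [List.replicate_succ, iterPartialDeriv_cons,
      mFourierCoeff_complexify_partialDeriv (hf.iterPartialDeriv _) j k,
      mFourierCoeff_complexify_iterPartialDeriv_replicate hf j k n, smul_smul, pow_succ]
    ring_nf

omit [DecidableEq d] in
/-- `‖𝓕g(k)‖ ≤ sup ‖g‖` for a smooth vector field (`‖𝓕g(k)‖ ≤ ∫‖g‖` on the probability torus).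
[cite: Grafakos2014, Prop. 3.2.6 (8)] -/
theorem norm_mFourierCoeff_complexify_le_of_forall_le {g : UnitAddTorus d → EuclideanSpace ℝ d}
    (hg : IsSmooth g) {C : ℝ} (hC : ∀ x, ‖g x‖ ≤ C) (k : d → ℤ) :
    ‖mFourierCoeff (EuclideanSpace.complexify ∘ g) k‖ ≤ C := by
  have hgi : MeasureTheory.Integrable g MeasureTheory.volume :=
    hg.continuous.integrable_of_hasCompactSupport (HasCompactSupport.of_compactSpace _)
  rw [mFourierCoeff_eq_integral_volume]
  have hint : MeasureTheory.Integrable (fun x => mFourier (-k) x • (EuclideanSpace.complexify ∘ g) x)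
      MeasureTheory.volume := integrable_mFourier_smul' (integrable_complexify_comp hgi) k
  refine (MeasureTheory.norm_integral_le_of_norm_le (MeasureTheory.integrable_const C)
    (MeasureTheory.ae_of_all _ fun x => ?_)).trans (by simp)
  rw [norm_smul, Function.comp_apply, EuclideanSpace.norm_complexify]
  exact (mul_le_of_le_one_left (norm_nonneg _) (((mFourier (-k)).norm_coe_le_norm x).trans_eq mFourier_norm)).trans
    (hC x)

/-- **Decay by integration by parts in one direction**: `‖𝓕f(k)‖ (2π|kⱼ|)ⁿ ≤ derivSup n f` for a
smooth vector field `f` and every direction `j`, order `n`, frequency `k`.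
[cite: Grafakos2014, Prop. 3.2.6 (8)] -/
theorem norm_mFourierCoeff_mul_pow_le_derivSup {f : UnitAddTorus d → EuclideanSpace ℝ d} (hf : IsSmooth f)
    (j : d) (k : d → ℤ) (n : ℕ) :
    ‖mFourierCoeff (EuclideanSpace.complexify ∘ f) k‖ * (2 * Real.pi * |(k j : ℝ)|) ^ n ≤ derivSup n f := by
  have h1 := mFourierCoeff_complexify_iterPartialDeriv_replicate hf j k n
  have h2 : ‖mFourierCoeff (EuclideanSpace.complexify ∘ iterPartialDeriv (List.replicate n j) f) k‖ ≤ derivSup n f := by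
    refine norm_mFourierCoeff_complexify_le_of_forall_le (hf.iterPartialDeriv _) (fun x => ?_) k
    have h := norm_iterPartialDeriv_le_derivSup hf (List.replicate n j) x
    rwa [List.length_replicate] at h
  rw [h1, norm_smul, norm_pow] at h2
  have e : ‖(2 * Real.pi * Complex.I * (k j) : ℂ)‖ = 2 * Real.pi * |(k j : ℝ)| := by
    rw [norm_mul, norm_mul, norm_mul, Complex.norm_I, mul_one, Complex.norm_ofNat, Complex.norm_real,
      Real.norm_of_nonneg Real.pi_pos.le, Complex.norm_intCast]
  rw [e] at h2
  linarith [h2, mul_comm (‖mFourierCoeff (EuclideanSpace.complexify ∘ f) k‖) ((2 * Real.pi * |(k j : ℝ)|) ^ n)]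

/-- **Fourier decay from the analyticity seminorm**: `⟦f⟧_{n,R} ≤ C` (`R > 0`) gives
`‖𝓕f(k)‖ ≤ C n! Rⁿ / ((n+1)² (2π|kⱼ|)ⁿ)` whenever `kⱼ ≠ 0`.
[cite: ArmstrongVicol2025, App. A (A.1)] [cite: Grafakos2014, Prop. 3.2.6 (8)] -/
theorem norm_mFourierCoeff_le_of_dnorm_le {f : UnitAddTorus d → EuclideanSpace ℝ d} (hf : IsSmooth f)
    {n : ℕ} {R C : ℝ} (hR : 0 < R) (h : dnorm n R f ≤ C) (k : d → ℤ) {j : d} (hkj : k j ≠ 0) :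
    ‖mFourierCoeff (EuclideanSpace.complexify ∘ f) k‖ ≤
      C * ((Nat.factorial n : ℝ) * R ^ n) / ((n : ℝ) + 1) ^ 2 / (2 * Real.pi * |(k j : ℝ)|) ^ n := by
  have hkpos : 0 < 2 * Real.pi * |(k j : ℝ)| := by
    have : (0 : ℝ) < |(k j : ℝ)| := abs_pos.2 (by exact_mod_cast hkj)
    positivity
  rw [le_div_iff₀ (pow_pos hkpos n)]
  refine (norm_mFourierCoeff_mul_pow_le_derivSup hf j k n).trans ?_
  -- `derivSup n f ≤ C n! Rⁿ/(n+1)²` from the seminorm bound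
  exact derivSup_le (by
      have hC : 0 ≤ C := (dnorm_nonneg n hR.le f).trans h
      positivity)
    fun l hl y => norm_iterPartialDeriv_le_of_dnorm_le hf hR h hl y

/-- **Geometric Fourier decay from the analyticity class** ("optimise the number of integrations by
parts"): if `⟦f⟧_{n,R} ≤ C` (`R > 0`) and the frequency is large in direction `j`, `R n ≤ π |kⱼ|`
(`kⱼ ≠ 0`), then `‖𝓕f(k)‖ ≤ C 2^{-n}/(n+1)²` (from `n! ≤ nⁿ` and `(R n/(2π|kⱼ|))ⁿ ≤ 2^{-n}`).
[cite: ArmstrongVicol2025, App. A (A.1)] [cite: Grafakos2014, Prop. 3.2.6 (8)] -/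
theorem norm_mFourierCoeff_le_geometric_of_dnorm_le {f : UnitAddTorus d → EuclideanSpace ℝ d} (hf : IsSmooth f)
    {n : ℕ} {R C : ℝ} (hR : 0 < R) (h : dnorm n R f ≤ C) (k : d → ℤ) {j : d} (hkj : k j ≠ 0)
    (hlarge : R * n ≤ Real.pi * |(k j : ℝ)|) :
    ‖mFourierCoeff (EuclideanSpace.complexify ∘ f) k‖ ≤ C * (1 / 2) ^ n / ((n : ℝ) + 1) ^ 2 := by
  have hC : 0 ≤ C := (dnorm_nonneg n hR.le f).trans h
  have hkabs : (0 : ℝ) < |(k j : ℝ)| := abs_pos.2 (by exact_mod_cast hkj)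
  have hK : 0 < 2 * Real.pi * |(k j : ℝ)| := by positivity
  refine (norm_mFourierCoeff_le_of_dnorm_le hf hR h k hkj).trans ?_
  -- `n! Rⁿ / (2π|kⱼ|)ⁿ ≤ (1/2)ⁿ`
  have hfac : (Nat.factorial n : ℝ) ≤ (n : ℝ) ^ n := by exact_mod_cast Nat.factorial_le_pow n
  have hratio : (Nat.factorial n : ℝ) * R ^ n / (2 * Real.pi * |(k j : ℝ)|) ^ n ≤ (1 / 2) ^ n := by
    rw [div_le_iff₀ (pow_pos hK n), ← mul_pow]
    calc (Nat.factorial n : ℝ) * R ^ n ≤ (n : ℝ) ^ n * R ^ n := mul_le_mul_of_nonneg_right hfac (pow_nonneg hR.le _)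
      _ = (R * n) ^ n := by rw [mul_pow, mul_comm]
      _ ≤ (1 / 2 * (2 * Real.pi * |(k j : ℝ)|)) ^ n :=
          pow_le_pow_left₀ (by positivity) (by linarith) n
  have e : C * ((Nat.factorial n : ℝ) * R ^ n) / ((n : ℝ) + 1) ^ 2 / (2 * Real.pi * |(k j : ℝ)|) ^ n =
      C / ((n : ℝ) + 1) ^ 2 * ((Nat.factorial n : ℝ) * R ^ n / (2 * Real.pi * |(k j : ℝ)|) ^ n) := by
    field_simp
  rw [e]
  calc C / ((n : ℝ) + 1) ^ 2 * ((Nat.factorial n : ℝ) * R ^ n / (2 * Real.pi * |(k j : ℝ)|) ^ n)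
      ≤ C / ((n : ℝ) + 1) ^ 2 * (1 / 2) ^ n := mul_le_mul_of_nonneg_left hratio (by positivity)
    _ = C * (1 / 2) ^ n / ((n : ℝ) + 1) ^ 2 := by ring

end Torus

end Literature.Analysis.FunctionSpaces

end
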